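import Literature.NumberTheory.GaloisCohomology.RestrictedRamificationExtComparisonLocalBridge
import Literature.NumberTheory.GaloisCohomology.RestrictedRamificationExtComparisonBidual
import Literature.NumberTheory.GaloisCohomology.PoitouTateRestrictedShaTwoLocalCriterion
import Literature.NumberTheory.GaloisCohomology.PoitouTateRestrictedShaExtRoad
import Literature.NumberTheory.GaloisCohomology.ArchimedeanInvariantMap
import Literature.NumberTheory.GaloisRepresentations.IdeleTruncatedSLocalArchVanishing
import Literature.NumberTheory.GaloisRepresentations.IdeleTruncatedSLocalSurjectivityZero
import Literature.NumberTheory.GaloisRepresentations.IdeleTruncatedSSubgroupHOne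
import Literature.NumberTheory.GaloisRepresentations.GalLayerSystemUnitsField
import Literature.NumberTheory.GaloisRepresentations.IdeleTruncatedSUnitsSequenceExact
import Literature.NumberTheory.GaloisRepresentations.IdeleClassBarSInvariant
import Literature.NumberTheory.GaloisRepresentations.RestrictedCohomologyFunctoriality
import Literature.Algebra.Homology.DiscreteRepCoindPresentation
import Literature.Algebra.Homology.DiscreteRepStandardResolution
import Literature.Algebra.Homology.DiscreteRepExtInternalHom
import HarnessLib

/-!
# `Ψ(E) = Ш²_S` on Milne's `Ext` road: the kit's hypothesis `hΨsha` outright, and `hΨsurj` from ONE displayed input,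
# the injectivity of `Ext²_{G_S}(·, Ī_S) → ∏_{w ∣ S ∪ ∞} Ext²_{Γ_{K_w}}(·, K̄_wˣ)` in its raw form [P2-mono] (Milne ADT I Lemma 4.13)

Topic `NumberTheory/GaloisCohomology`; namespace `Literature.NumberTheory.GaloisCohomology.ShaExtRoadKit`.  Theorems only
(no definition, no named fact, no instance, no notation, no `sorry`).  Lane «PT-Ш-S-TC» of cell `bsd-eis` (crux
`GoodLatticeBDPValue`, `stmt-BirchSwinnertonDyer-19032`), KIT GLUE (seat bsd-line-x1-p1-w2 gen 12): the two `Ψ`-binders of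
`ShaExtRoadKit.natural_at_of_idele_class_formation'` (the lane's closer recipe, -w2 g11) —

* `hΨsha`: `Ψ x := cmp (x ∘ [T]) ∈ Ш²_S(K, M)` for every `x ∈ Ext¹_{C_{G_S}}(⟨(M^D(n))^{N_S}⟩, C̄_S)`, and
* `hΨsurj`: every class of `Ш²_S(K, M)` is a `Ψ x`,

where `T = (Ē_S → Ī_S → C̄_S)` is the tree's `S`-idèle class formation (`IdeleClassBar.truncSeqS`) and
`cmp = RestrictedExtCmp.cmp` is the two-level comparison `Ext²(⟨(M^D(n))^{N_S}⟩, ⟨Ē_S⟩) ≃ H²(G_S, (M^{DD})^{N_S}) ≃ H²(G_S, M^{N_S})`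
— are DERIVED, for every admissible `(n, M, ρ)` at once: `hΨsha` OUTRIGHT, and `hΨsurj` from ONE displayed hypothesis, the raw cohomological input
[P2-mono] of the permutation dévissage (bsd-eis -w3 g18 / -w4 g20), i.e. "a class of `H²(U, Ī_S)` all of whose
`(w, t)`-components in `H²(φ_w⁻¹(s_t U s_t⁻¹), K̄_wˣ)` vanish is zero" for the open normal subgroups `U ≤ G_S`
(Milne I Lemma 4.13 at `r = 2` through Shapiro; Harari Prop. 17.25 / 17.26).

Assembly (Milne, ADT I, proof of Thm. 4.10 (a), p. 58; Harari §17.5), all inputs by name: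
* §1 `H^{q+1}(F, N) = 0` when `Γ_F` is trivial (`Ext^{q+1}_{C_Γ}(ℤ, ·) = 0` over a trivial group: every object is
  co-induced, `DiscreteRep.isoCoindOfForallEqOne`, and `ℤ` is projective; comparison `extTrivAddEquivGaloisCohomology`),
  hence the archimedean localisations of `Hʳ(G_S, ·)`, `r ≥ 1`, vanish for `K` totally complex — the degree-2 `harch`
  of `RestrictedExt.cmp_comp_extClass_mem_shaRestricted`;
* §2 `idLocMap_injective_two_of_P2mono`: injectivity of -w4 g20's localisation `idLocMap K S A 2` for every FINITE `A`
  from [P2-mono] alone (`IdeleReadout.idLocMap_injective_two_of_inputs''` at an open normal subgroup fixing `A`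
  (`exists_openNormalSubgroup_forall_apply_eq`), with [P1-mono] = `IdeleClassBar.ext_one_triv_resD_truncIdeleBarD_eq_zero`
  and [P1-epi-local] = `ext_one_res_units_eq_zero` discharged);
* §3 the two binders at one admissible `(n, M, ρ)` — `hΨsha_at` OUTRIGHT (no injectivity is needed on that side) and
  `hΨsurj_at_of_idLocMap_injective` from `hinj : Injective (idLocMap K S ⟨(M^D(n))^{N_S}⟩ 2)`:
  -w7 g13's `Λ := lambdaLoc` at level `d := #M` and module `M^D(n)` with (Λ1) `hΛ1_lambdaLoc` and (Λ2)
  `hΛ2_lambdaLoc_of_idLocMap_injective` (+ LEAD g11's `harch0 = idLocMap_two_inl_eq_zero`), -w7 g12's criteria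
  `cmp_comp_extClass_mem_shaRestricted` / `exists_cmp_comp_extClass_eq_of_mem_shaRestricted'` for the module
  `(M^D(n))^D(d)`, and the transport `Ш²_S(K, M^{DD}) ↔ Ш²_S(K, M)` along the biduality
  (`RestrictedExtCmp.bidualTransport` / `bidualCotransport`, -w2 g11's `map_mem_shaRestricted`);
* §4 the ∀-packaged forms: `hΨsha` = the kit's binder VERBATIM with NO hypothesis, `hΨsurj_of_P2mono` = the kit's binder
  VERBATIM behind [P2-mono].

HONEST FRAMING: plumbing with one displayed hypothesis; [P2-mono] is NOT proved here; no case of Poitou–Tate duality and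
nothing about BSD is proved here.  AI formalisation, established only by the kernel check.

## References
* J. S. Milne, *Arithmetic Duality Theorems*, 2nd ed. (2006), I Lemma 4.13, I Thm. 4.10 (a) and its proof (p. 58),
  I §0 Prop. 0.19 (biduality). [MilneADT2006]
* D. Harari, *Galois Cohomology and Class Field Theory*, Universitext (2020), §4.3 Remark 4.24, Prop. 17.25, Prop. 17.26,
  §17.5. [Harari2020]
* J.-P. Serre, *Galois Cohomology* (1997), I §2.5, II §6.3 (archimedean places). [SerreGaloisCohomology1997]
-/

noncomputable section

open CategoryTheory CategoryTheory.Abelian NumberField IsDedekindDomain Function Field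
open scoped NumberField ContRepresentation

namespace Literature.NumberTheory.GaloisCohomology

namespace ShaExtRoadKit

open Literature.Algebra.Homology Literature.Algebra.Homology.DiscreteRep Literature.Algebra.Homology.ExtDuality
open Literature.NumberTheory.GaloisRepresentations
open Literature.NumberTheory.GaloisRepresentations.DiscreteGaloisModule

/-! ## §1 `H^{q+1}(F, N) = 0` over a trivial absolute Galois group; archimedean localisations for `K` totally complex -/

/-- **`H^{q+1}(F, N) = 0` when `Γ_F` is trivial** (every degree `≥ 1`, every discrete module `N`): through the comparison
`Ext^{q+1}_{C_{Γ_F}}(ℤ, N) ≃ H^{q+1}(F, N)`; over a trivial group every object of `C_Γ` is co-induced and `ℤ` is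
projective, so `Ext^{≥ 1}(ℤ, ·) = 0`. [cite: SerreGaloisCohomology1997, I §2.5][cite: Harari2020, §4.3 Remark 4.24] -/
theorem subsingleton_galoisCohomology_succ_of_forall_eq_one {F : Type} [Field F]
    [CompactSpace (absoluteGaloisGroup F)] (hF : ∀ σ : absoluteGaloisGroup F, σ = 1)
    {N : Type} [AddCommGroup N] [TopologicalSpace N] [DiscreteTopology N] (τ : DiscreteGaloisModule F N) (q : ℕ) :
    Subsingleton (galoisCohomology τ (q + 1)) := by
  have h0 : ∀ z : Ext (triv (Γ := absoluteGaloisGroup F) ℤ) (ofDiscreteGaloisModule τ) (q + 1), z = 0 := fun z =>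
    ext_eq_zero_of_iso_coind_of_projective (triv (Γ := absoluteGaloisGroup F) ℤ)
      (isoCoindOfForallEqOne hF (ofDiscreteGaloisModule τ)) q z
  refine ⟨fun x y => ?_⟩
  obtain ⟨x', rfl⟩ := (extTrivAddEquivGaloisCohomology τ (q + 1)).surjective x
  obtain ⟨y', rfl⟩ := (extTrivAddEquivGaloisCohomology τ (q + 1)).surjective y
  rw [h0 x', h0 y']

variable {K : Type} [Field K] [NumberField K]

/-- **`H^{q+1}(K_w, N) = 0` at a complex place `w`.** [cite: SerreGaloisCohomology1997, II §6.3][cite: MilneADT2006, I Thm. 4.10 (a)] -/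
theorem subsingleton_galoisCohomology_succ_toLocal_inl_of_isComplex {w : InfinitePlace K} (hw : w.IsComplex)
    {N : Type} [AddCommGroup N] [TopologicalSpace N] [DiscreteTopology N] (τ : DiscreteGaloisModule K N) (q : ℕ) :
    Subsingleton (galoisCohomology (τ.toLocal (Sum.inl w)) (q + 1)) :=
  haveI : CompactSpace (absoluteGaloisGroup (Place.Completion (K := K) (Sum.inl w))) :=
    absoluteGaloisGroup_compactSpace _
  subsingleton_galoisCohomology_succ_of_forall_eq_one (eq_one_absoluteGaloisGroup_of_isComplex hw) _ q

/-- **For `K` totally complex the archimedean localisations of `Hʳ(G_S, N^{N_S})`, `r ≥ 1`, vanish** — the degree-2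
hypothesis `harch` of `RestrictedExt.cmp_comp_extClass_mem_shaRestricted` (and every higher degree).
[cite: MilneADT2006, I Thm. 4.10 (a) (the archimedean factors)][cite: SerreGaloisCohomology1997, II §6.3] -/
theorem restrictedLocalization_inl_succ_eq_zero [IsTotallyComplex K]
    {N : Type} [AddCommGroup N] [TopologicalSpace N] [DiscreteTopology N] (τ : DiscreteGaloisModule K N)
    (S : Set (HeightOneSpectrum (𝓞 K))) (q : ℕ) (w : InfinitePlace K) (c : restrictedCohomology τ S (q + 1)) :
    restrictedLocalization τ S (Sum.inl w) (q + 1) c = 0 :=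
  haveI := subsingleton_galoisCohomology_succ_toLocal_inl_of_isComplex (IsTotallyComplex.isComplex w) τ q
  Subsingleton.elim _ _

/-! ## §2 Injectivity of `idLocMap K S A 2` for finite `A` from [P2-mono] -/

variable (K) (S : Finset (HeightOneSpectrum (𝓞 K)))

set_option maxRecDepth 16384 in
/-- **`Ext²_{G_S}(A, Ī_S) → ∏_{w ∣ S ∪ ∞} Ext²_{Γ_{K_w}}(φ_w^* A, K̄_wˣ)` is injective for every FINITE `A`, granted [P2-mono]**
at the open normal subgroups of `G_S` (Milne I Lemma 4.13 at `r = 2`): -w4 g20's `idLocMap_injective_two_of_inputs''` at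
an open normal `U` fixing `A` pointwise, with [P1-mono] (`H¹(U, Ī_S) = 0`) and [P1-epi-local] (Hilbert 90 at the open
subgroups of the `Γ_{K_w}`) discharged by the tree. [cite: MilneADT2006, I Lemma 4.13][cite: Harari2020, Prop. 17.25, Prop. 17.26] -/
theorem idLocMap_injective_two_of_P2mono
    (A : DiscreteRepCat ℤ (GaloisGroupUnramifiedOutside K (↑S : Set (HeightOneSpectrum (𝓞 K))))) [Finite A.obj.V]
    (hP2 : ∀ (U : Subgroup (GaloisGroupUnramifiedOutside K (↑S : Set (HeightOneSpectrum (𝓞 K))))) [U.Normal]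
      (_ : IsOpen (U : Set (GaloisGroupUnramifiedOutside K (↑S : Set (HeightOneSpectrum (𝓞 K)))))) [U.FiniteIndex],
      ∀ y : Ext (triv (k := ℤ) (Γ := ↥U) ℤ) ((resD ℤ U).obj (IdeleClassBar.truncIdeleBarD K S)) 2,
        (∀ (w : IdeleReadout.OverS K S) (t : DoubleCosets (IdeleReadout.decompMapPlaceS K S w.1) U),
          (y.mapExactFunctor (resDHom ℤ (conjHom (IdeleReadout.decompMapPlaceS K S w.1) U
              (dcRep (IdeleReadout.decompMapPlaceS K S w.1) U t))
            (continuous_conjHom (IdeleReadout.decompMapPlaceS K S w.1) (IdeleReadout.continuous_decompMapPlaceS K S w.1) U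
              (dcRep (IdeleReadout.decompMapPlaceS K S w.1) U t)))).comp
            (Ext.mk₀ (conjCoeff (IdeleReadout.decompMapPlaceS K S w.1) (IdeleReadout.continuous_decompMapPlaceS K S w.1) U
              (IdeleClassBar.truncIdeleBarD K S) (IdeleReadout.unitsD (Place.Completion w.1)) (IdeleReadout.locQ K S w)
              (dcRep (IdeleReadout.decompMapPlaceS K S w.1) U t) (k := ℤ))) (add_zero 2) = 0) → y = 0) :
    Function.Injective (IdeleReadout.idLocMap K S A 2) := by
  classical
  letI : Module ℤ A.obj.V := A.obj.hV2
  haveI : Module.Finite ℤ A.obj.V := Module.Finite.of_finite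
  haveI := IdeleClassBar.totallyDisconnectedSpace_GS (K := K) S
  obtain ⟨U, hUA⟩ := exists_openNormalSubgroup_forall_apply_eq (k := ℤ) A
  haveI := Subgroup.quotient_finite_of_isOpen
    (U : Subgroup (GaloisGroupUnramifiedOutside K (↑S : Set (HeightOneSpectrum (𝓞 K))))) U.isOpen
  haveI : (U : Subgroup (GaloisGroupUnramifiedOutside K (↑S : Set (HeightOneSpectrum (𝓞 K))))).FiniteIndex :=
    Subgroup.finiteIndex_of_finite_quotient
  refine IdeleReadout.idLocMap_injective_two_of_inputs'' K S A U U.isOpen hUA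
    (fun y => IdeleClassBar.ext_one_triv_resD_truncIdeleBarD_eq_zero K S U U.isOpen y) (fun w z => ?_)
    (hP2 U U.isOpen)
  haveI : CharZero (Place.Completion (K := K) w.1) :=
    charZero_of_injective_algebraMap (algebraMap K (Place.Completion (K := K) w.1)).injective
  haveI : IsGalois (Place.Completion (K := K) w.1) (AlgebraicClosure (Place.Completion (K := K) w.1)) := {}
  haveI : CompactSpace (absoluteGaloisGroup (Place.Completion (K := K) w.1)) := absoluteGaloisGroup_compactSpace _
  exact ext_one_res_units_eq_zero _ (U.isOpen.preimage (IdeleReadout.continuous_decompMapPlaceS K S w.1)) z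

/-! ## §3 The two `Ψ`-binders at one admissible `(n, M, ρ)`: `hΨsha` outright, `hΨsurj` from the injectivity of `idLocMap` -/

variable (n : ℕ) [NeZero n] {M : Type} [AddCommGroup M] [TopologicalSpace M] [DiscreteTopology M] [Finite M]
  [Finite (TateDual K M n)] [NeZero (Nat.card M)] (ρ : DiscreteGaloisModule K M)

set_option maxRecDepth 16384 in
-- (as in the lane's kit files: the composed `Ext`/`Hʳ` objects exceed the default recursion depth)
/-- **`hΨsha` at `(n, M, ρ)` — UNCONDITIONALLY for `K` totally complex**: `Ψ x = cmp (x ∘ [T]) ∈ Ш²_S(K, M)` for every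
`x ∈ Ext¹(⟨(M^D(n))^{N_S}⟩, C̄_S)` — Milne's argument at the module `(M^D(n))^D(#M)` ((Λ1) `hΛ1_lambdaLoc` and the archimedean
vanishing of §1; NO injectivity is needed on this side) transported along the biduality `(M^{DD})^{N_S} → M^{N_S}`.
[cite: MilneADT2006, I Thm. 4.10 (a) (proof, p. 58), I Lemma 4.13][cite: Harari2020, Prop. 17.25, §17.5] -/
theorem hΨsha_at [IsTotallyComplex K] (hn : ∀ m : M, n • m = 0)
    (hur : GaloisRep.IsUnramifiedOutside (↑S : Set (HeightOneSpectrum (𝓞 K))) ρ)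
    (hS : ∀ v : HeightOneSpectrum (𝓞 K), ((Nat.card M : ℕ) : 𝓞 K) ∈ v.asIdeal → v ∈ (↑S : Set (HeightOneSpectrum (𝓞 K))))
    (x : Ext (ofContinuousRep ((ρ.tateDual n).quotientInvariants
        (ramificationSubgroup K (↑S : Set (HeightOneSpectrum (𝓞 K)))))) (IdeleClassBar.classBarSD K S) 1) :
    ShaExtRoad.obstruction ρ (↑S : Set (HeightOneSpectrum (𝓞 K))) (IdeleClassBar.truncSeqS_shortExact (K := K) (S := S))
      (ofContinuousRep ((ρ.tateDual n).quotientInvariants (ramificationSubgroup K (↑S : Set (HeightOneSpectrum (𝓞 K))))))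
      (RestrictedExtCmp.cmp (↑S : Set (HeightOneSpectrum (𝓞 K))) ρ n (Nat.card M)
        (fun _ => card_nsmul_eq_zero') hS hn ((isUnramifiedOutside_iff_ramificationSubgroup_le_ker ρ _).1 hur) 2) x ∈
      shaRestricted ρ (↑S : Set (HeightOneSpectrum (𝓞 K))) 2 := by
  -- abbreviations: `d = #M`, `ρ₀ = M^D(n)`, the torsion / ramification bookkeeping at level `d`
  have hd : ∀ m : M, Nat.card M • m = 0 := fun _ => card_nsmul_eq_zero'
  have hker : ramificationSubgroup K (↑S : Set (HeightOneSpectrum (𝓞 K))) ≤ ContinuousRep.ker ρ :=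
    (isUnramifiedOutside_iff_ramificationSubgroup_le_ker ρ _).1 hur
  have hM' : ∀ φ : TateDual K M n, Nat.card M • φ = 0 := nsmul_tateDual_eq_zero_of_nsmul n (Nat.card M) hd
  have hur' : ramificationSubgroup K (↑S : Set (HeightOneSpectrum (𝓞 K))) ≤ ContinuousRep.ker (ρ.tateDual n) :=
    RestrictedExtCmp.ramificationSubgroup_le_ker_tateDual (↑S : Set (HeightOneSpectrum (𝓞 K))) ρ n (Nat.card M) hd hS hker
  -- Milne's argument at the module `(M^D(n))^D(d)`: `E (x ∘ [T]) ∈ Ш²_S(K, M^{DD})`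
  have hmem := RestrictedExt.cmp_comp_extClass_mem_shaRestricted ((ρ.tateDual n).tateDual (Nat.card M))
    (↑S : Set (HeightOneSpectrum (𝓞 K))) (IdeleClassBar.truncSeqS_shortExact (K := K) (S := S))
    (ofContinuousRep ((ρ.tateDual n).quotientInvariants (ramificationSubgroup K (↑S : Set (HeightOneSpectrum (𝓞 K))))))
    (RestrictedExt.extAddEquivRestrictedCohomologyTateDual K (↑S : Set (HeightOneSpectrum (𝓞 K))) (Nat.card M)
      (ρ.tateDual n) hS hM' hur' 2).toAddMonoidHom
    (fun v _ => RestrictedExt.lambdaLoc K S (Nat.card M) (ρ.tateDual n) v hM' hur' 2)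
    (RestrictedExt.hΛ1_lambdaLoc K S (Nat.card M) (ρ.tateDual n) hS hM' hur')
    (fun w c => restrictedLocalization_inl_succ_eq_zero ((ρ.tateDual n).tateDual (Nat.card M)) _ 1 w c) x
  -- transport along `Hʳ(G_S, κ)`, `κ : (M^{DD})^{N_S} → M^{N_S}` the inverse biduality (`cmp = Hʳ(κ) ∘ E` and
  -- `bidualTransport_apply` hold by `rfl`)
  rw [ShaExtRoad.obstruction_apply]
  change RestrictedExtCmp.bidualTransport (↑S : Set (HeightOneSpectrum (𝓞 K))) ρ n (Nat.card M) hd hn 2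
    (RestrictedExt.extAddEquivRestrictedCohomologyTateDual K (↑S : Set (HeightOneSpectrum (𝓞 K))) (Nat.card M)
      (ρ.tateDual n) hS hM' hur' 2 (x.comp (IdeleClassBar.truncSeqS_shortExact (K := K) (S := S)).extClass
        (rfl : 1 + 1 = 2))) ∈ shaRestricted ρ (↑S : Set (HeightOneSpectrum (𝓞 K))) 2
  rw [RestrictedExtCmp.bidualTransport_apply]
  exact DiscreteGaloisModule.map_mem_shaRestricted (TopRep.ofHom (bidualInv₂ ρ n (Nat.card M) hd hn))
    (↑S : Set (HeightOneSpectrum (𝓞 K))) 2 hmem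

set_option maxRecDepth 16384 in
-- (as in the lane's kit files: the composed `Ext`/`Hʳ` objects exceed the default recursion depth)
/-- **`hΨsurj` at `(n, M, ρ)` from the injectivity of `idLocMap K S ⟨(M^D(n))^{N_S}⟩ 2`** (`K` totally complex): every
class of `Ш²_S(K, M)` is `cmp (x ∘ [T])` for some `x ∈ Ext¹(⟨(M^D(n))^{N_S}⟩, C̄_S)` — pull the class back along the
biduality to `Ш²_S(K, M^{DD})`, apply Milne's exactness argument there ((Λ1) `hΛ1_lambdaLoc`, (Λ2)
`hΛ2_lambdaLoc_of_idLocMap_injective` with `harch0 = idLocMap_two_inl_eq_zero`), and push forward again.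
[cite: MilneADT2006, I Thm. 4.10 (a) (proof, p. 58), I Lemma 4.13][cite: Harari2020, Prop. 17.25, §17.5] -/
theorem hΨsurj_at_of_idLocMap_injective [IsTotallyComplex K] (hn : ∀ m : M, n • m = 0)
    (hur : GaloisRep.IsUnramifiedOutside (↑S : Set (HeightOneSpectrum (𝓞 K))) ρ)
    (hS : ∀ v : HeightOneSpectrum (𝓞 K), ((Nat.card M : ℕ) : 𝓞 K) ∈ v.asIdeal → v ∈ (↑S : Set (HeightOneSpectrum (𝓞 K))))
    (hinj : Function.Injective (IdeleReadout.idLocMap K S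
      (ofContinuousRep ((ρ.tateDual n).quotientInvariants (ramificationSubgroup K (↑S : Set (HeightOneSpectrum (𝓞 K)))))) 2))
    (c : restrictedCohomology ρ (↑S : Set (HeightOneSpectrum (𝓞 K))) 2)
    (hc : c ∈ shaRestricted ρ (↑S : Set (HeightOneSpectrum (𝓞 K))) 2) :
    ∃ x : Ext (ofContinuousRep ((ρ.tateDual n).quotientInvariants
        (ramificationSubgroup K (↑S : Set (HeightOneSpectrum (𝓞 K)))))) (IdeleClassBar.classBarSD K S) 1,
      ShaExtRoad.obstruction ρ (↑S : Set (HeightOneSpectrum (𝓞 K))) (IdeleClassBar.truncSeqS_shortExact (K := K) (S := S))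
        (ofContinuousRep ((ρ.tateDual n).quotientInvariants (ramificationSubgroup K (↑S : Set (HeightOneSpectrum (𝓞 K))))))
        (RestrictedExtCmp.cmp (↑S : Set (HeightOneSpectrum (𝓞 K))) ρ n (Nat.card M)
          (fun _ => card_nsmul_eq_zero') hS hn ((isUnramifiedOutside_iff_ramificationSubgroup_le_ker ρ _).1 hur) 2) x = c := by
  have hd : ∀ m : M, Nat.card M • m = 0 := fun _ => card_nsmul_eq_zero'
  have hker : ramificationSubgroup K (↑S : Set (HeightOneSpectrum (𝓞 K))) ≤ ContinuousRep.ker ρ :=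
    (isUnramifiedOutside_iff_ramificationSubgroup_le_ker ρ _).1 hur
  have hM' : ∀ φ : TateDual K M n, Nat.card M • φ = 0 := nsmul_tateDual_eq_zero_of_nsmul n (Nat.card M) hd
  have hur' : ramificationSubgroup K (↑S : Set (HeightOneSpectrum (𝓞 K))) ≤ ContinuousRep.ker (ρ.tateDual n) :=
    RestrictedExtCmp.ramificationSubgroup_le_ker_tateDual (↑S : Set (HeightOneSpectrum (𝓞 K))) ρ n (Nat.card M) hd hS hker
  -- pull `c` back to `Ш²_S(K, M^{DD})` along `Hʳ(G_S, ι)`, `ι` the biduality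
  have hc' : RestrictedExtCmp.bidualCotransport (↑S : Set (HeightOneSpectrum (𝓞 K))) ρ n (Nat.card M) hd 2 c ∈
      shaRestricted ((ρ.tateDual n).tateDual (Nat.card M)) (↑S : Set (HeightOneSpectrum (𝓞 K))) 2 := by
    rw [RestrictedExtCmp.bidualCotransport_apply]
    exact DiscreteGaloisModule.map_mem_shaRestricted (TopRep.ofHom (bidual₂ ρ n (Nat.card M) hd))
      (↑S : Set (HeightOneSpectrum (𝓞 K))) 2 hc
  -- Milne's exactness argument at the module `(M^D(n))^D(d)`
  obtain ⟨x, hx⟩ := RestrictedExt.exists_cmp_comp_extClass_eq_of_mem_shaRestricted'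
    ((ρ.tateDual n).tateDual (Nat.card M)) (↑S : Set (HeightOneSpectrum (𝓞 K)))
    (IdeleClassBar.truncSeqS_shortExact (K := K) (S := S))
    (ofContinuousRep ((ρ.tateDual n).quotientInvariants (ramificationSubgroup K (↑S : Set (HeightOneSpectrum (𝓞 K))))))
    (fun v _ => RestrictedExt.lambdaLoc K S (Nat.card M) (ρ.tateDual n) v hM' hur' 2)
    (RestrictedExt.extAddEquivRestrictedCohomologyTateDual K (↑S : Set (HeightOneSpectrum (𝓞 K))) (Nat.card M)
      (ρ.tateDual n) hS hM' hur' 2)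
    (RestrictedExt.hΛ1_lambdaLoc K S (Nat.card M) (ρ.tateDual n) hS hM' hur')
    (RestrictedExt.hΛ2_lambdaLoc_of_idLocMap_injective K S (Nat.card M) (ρ.tateDual n) hM' hur' hinj
      (IdeleReadout.idLocMap_two_inl_eq_zero K S _))
    _ hc'
  refine ⟨x, ?_⟩
  rw [ShaExtRoad.obstruction_apply]
  change RestrictedExtCmp.bidualTransport (↑S : Set (HeightOneSpectrum (𝓞 K))) ρ n (Nat.card M) hd hn 2
    (RestrictedExt.extAddEquivRestrictedCohomologyTateDual K (↑S : Set (HeightOneSpectrum (𝓞 K))) (Nat.card M)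
      (ρ.tateDual n) hS hM' hur' 2 (x.comp (IdeleClassBar.truncSeqS_shortExact (K := K) (S := S)).extClass
        (rfl : 1 + 1 = 2))) = c
  exact (congrArg (RestrictedExtCmp.bidualTransport (↑S : Set (HeightOneSpectrum (𝓞 K))) ρ n (Nat.card M) hd hn 2) hx).trans
    (RestrictedExtCmp.bidualTransport_bidualCotransport (↑S : Set (HeightOneSpectrum (𝓞 K))) ρ n (Nat.card M) hd hn 2 c)

/-! ## §4 The kit's binders: `hΨsha` VERBATIM and unconditionally, `hΨsurj` VERBATIM behind the single displayed input [P2-mono] -/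

variable {n ρ}

omit [NumberField K] [NeZero n] [NeZero (Nat.card M)] in
/-- `⟨(M^D(n))^{N_S}⟩` has finitely many vectors. [cite: MilneADT2006, I §0] -/
theorem finite_obj_ofContinuousRep_quotientInvariants_tateDual :
    Finite (ofContinuousRep ((ρ.tateDual n).quotientInvariants
      (ramificationSubgroup K (↑S : Set (HeightOneSpectrum (𝓞 K)))))).obj.V :=
  Subtype.finite

variable (n ρ)

set_option maxRecDepth 16384 in
-- (as in the lane's kit files: the composed `Ext`/`Hʳ` objects exceed the default recursion depth)
/-- **`hΨsha` OF THE CLOSER'S KIT, VERBATIM — no hypothesis** (`K` totally complex): for every admissible `(n, M, ρ)` and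
every `x ∈ Ext¹(⟨(M^D(n))^{N_S}⟩, C̄_S)`, `Ψ x = cmp (x ∘ [T]) ∈ Ш²_S(K, M)`.
[cite: MilneADT2006, I Thm. 4.10 (a) (proof, p. 58), I Lemma 4.13][cite: Harari2020, Prop. 17.25, Prop. 17.26, §17.5] -/
theorem hΨsha [IsTotallyComplex K] :
    ∀ (n : ℕ) [NeZero n] (M : Type) [AddCommGroup M] [TopologicalSpace M] [DiscreteTopology M]
      [Finite M] [Finite (TateDual K M n)] [NeZero (Nat.card M)] (ρ : DiscreteGaloisModule K M)
      (hn : ∀ m : M, n • m = 0) (hur : GaloisRep.IsUnramifiedOutside (↑S : Set (HeightOneSpectrum (𝓞 K))) ρ)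
      (hS : ∀ v : HeightOneSpectrum (𝓞 K), ((Nat.card M : ℕ) : 𝓞 K) ∈ v.asIdeal → v ∈ (↑S : Set (HeightOneSpectrum (𝓞 K)))),
      ∀ x : Ext (ofContinuousRep ((ρ.tateDual n).quotientInvariants
        (ramificationSubgroup K (↑S : Set (HeightOneSpectrum (𝓞 K)))))) (IdeleClassBar.classBarSD K S) 1,
        ShaExtRoad.obstruction ρ (↑S : Set (HeightOneSpectrum (𝓞 K))) (IdeleClassBar.truncSeqS_shortExact (K := K) (S := S)) (ofContinuousRep ((ρ.tateDual n).quotientInvariants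
        (ramificationSubgroup K (↑S : Set (HeightOneSpectrum (𝓞 K))))))
          (RestrictedExtCmp.cmp (↑S : Set (HeightOneSpectrum (𝓞 K))) ρ n (Nat.card M)
            (fun _ => card_nsmul_eq_zero') hS hn ((isUnramifiedOutside_iff_ramificationSubgroup_le_ker ρ _).1 hur) 2) x ∈ shaRestricted ρ (↑S : Set (HeightOneSpectrum (𝓞 K))) 2 :=
  fun n _ _ _ _ _ _ _ _ ρ hn hur hS x => hΨsha_at K S n ρ hn hur hS x

set_option maxRecDepth 16384 in
-- (as in the lane's kit files: the composed `Ext`/`Hʳ` objects exceed the default recursion depth)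
/-- **`hΨsurj` OF THE CLOSER'S KIT, VERBATIM, behind [P2-mono]** (`K` totally complex): for every admissible `(n, M, ρ)`,
every class of `Ш²_S(K, M)` is `Ψ x = cmp (x ∘ [T])` for some `x ∈ Ext¹(⟨(M^D(n))^{N_S}⟩, C̄_S)`.
[cite: MilneADT2006, I Thm. 4.10 (a) (proof, p. 58), I Lemma 4.13][cite: Harari2020, Prop. 17.25, Prop. 17.26, §17.5] -/
theorem hΨsurj_of_P2mono [IsTotallyComplex K]
    (hP2 : ∀ (U : Subgroup (GaloisGroupUnramifiedOutside K (↑S : Set (HeightOneSpectrum (𝓞 K))))) [U.Normal]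
      (_ : IsOpen (U : Set (GaloisGroupUnramifiedOutside K (↑S : Set (HeightOneSpectrum (𝓞 K)))))) [U.FiniteIndex],
      ∀ y : Ext (triv (k := ℤ) (Γ := ↥U) ℤ) ((resD ℤ U).obj (IdeleClassBar.truncIdeleBarD K S)) 2,
        (∀ (w : IdeleReadout.OverS K S) (t : DoubleCosets (IdeleReadout.decompMapPlaceS K S w.1) U),
          (y.mapExactFunctor (resDHom ℤ (conjHom (IdeleReadout.decompMapPlaceS K S w.1) U
              (dcRep (IdeleReadout.decompMapPlaceS K S w.1) U t))
            (continuous_conjHom (IdeleReadout.decompMapPlaceS K S w.1) (IdeleReadout.continuous_decompMapPlaceS K S w.1) U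
              (dcRep (IdeleReadout.decompMapPlaceS K S w.1) U t)))).comp
            (Ext.mk₀ (conjCoeff (IdeleReadout.decompMapPlaceS K S w.1) (IdeleReadout.continuous_decompMapPlaceS K S w.1) U
              (IdeleClassBar.truncIdeleBarD K S) (IdeleReadout.unitsD (Place.Completion w.1)) (IdeleReadout.locQ K S w)
              (dcRep (IdeleReadout.decompMapPlaceS K S w.1) U t) (k := ℤ))) (add_zero 2) = 0) → y = 0) :
    ∀ (n : ℕ) [NeZero n] (M : Type) [AddCommGroup M] [TopologicalSpace M] [DiscreteTopology M]
      [Finite M] [Finite (TateDual K M n)] [NeZero (Nat.card M)] (ρ : DiscreteGaloisModule K M)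
      (hn : ∀ m : M, n • m = 0) (hur : GaloisRep.IsUnramifiedOutside (↑S : Set (HeightOneSpectrum (𝓞 K))) ρ)
      (hS : ∀ v : HeightOneSpectrum (𝓞 K), ((Nat.card M : ℕ) : 𝓞 K) ∈ v.asIdeal → v ∈ (↑S : Set (HeightOneSpectrum (𝓞 K)))),
      ∀ c ∈ shaRestricted ρ (↑S : Set (HeightOneSpectrum (𝓞 K))) 2, ∃ x : Ext (ofContinuousRep ((ρ.tateDual n).quotientInvariants
        (ramificationSubgroup K (↑S : Set (HeightOneSpectrum (𝓞 K)))))) (IdeleClassBar.classBarSD K S) 1,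
        ShaExtRoad.obstruction ρ (↑S : Set (HeightOneSpectrum (𝓞 K))) (IdeleClassBar.truncSeqS_shortExact (K := K) (S := S)) (ofContinuousRep ((ρ.tateDual n).quotientInvariants
        (ramificationSubgroup K (↑S : Set (HeightOneSpectrum (𝓞 K))))))
          (RestrictedExtCmp.cmp (↑S : Set (HeightOneSpectrum (𝓞 K))) ρ n (Nat.card M)
            (fun _ => card_nsmul_eq_zero') hS hn ((isUnramifiedOutside_iff_ramificationSubgroup_le_ker ρ _).1 hur) 2) x = c :=
  fun n _ _ _ _ _ _ _ _ ρ hn hur hS c hc =>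
    haveI := finite_obj_ofContinuousRep_quotientInvariants_tateDual K S (n := n) (ρ := ρ)
    hΨsurj_at_of_idLocMap_injective K S n ρ hn hur hS (idLocMap_injective_two_of_P2mono K S _ hP2) c hc

end ShaExtRoadKit

end Literature.NumberTheory.GaloisCohomology

end
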